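import Summits.Ventures.Crystal3D.Theorems.StickyWulffConstantCoaxialWallLawEndRowOuterShell
import Summits.Ventures.Crystal3D.Theorems.StickyWulffConstantCoaxialWallLawOnSiteBridgeCxTwoSqrtSix
import HarnessLib

/-!
# DELETION OF INESSENTIAL BALLS: the (A) census summand does not decrease when balls touching nothing near the payer go
# (crux `CoaxialWallLaw`, stmt-Ventures-19481, line `WallLedgerF`; census-free reduction of the OFF-MODULE tails)

HONEST FRAMING. Venture `Summits/Ventures/Crystal3D` (cell `crystal3d-full`), helper `--supports` the crux
`CoaxialWallLaw` (stmt-Ventures-19481, `route-Ventures-StickyWulffConstant`), REGISTERED line `WallLedgerF` (planner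
cf-p1, (lxxiv): the off-module tails `EndRowTransTailA / EndRowTwinTailA v2 (2√6) coaxialModuleUniverse`; also T-F2's
`EndRowJointTailA`).  Rung credit; F-C1 not moved; census-free (std axioms).

THE THEOREM (`localSummandA_le_of_deletion`).  Let `X' ⊆ X` be finite configurations, `X` `1`-separated, `z ∈ X'`, and
suppose every DELETED ball `x ∈ X ∖ X'` touches NO ball of `X'` within distance `2` of `z`
(`∀ x ∈ X, x ∉ X' → ∀ y ∈ X', dist z y ≤ 2 → dist x y ≠ 1`).  Then for any two plate systems with slot roots
`localSummandA v S₁ S₂ X z ≤ localSummandA v S₁ S₂ X' z`.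
MECHANISM: every end ball `b` (within `1` of `z`), every reader `q` of it (within `2`), every reading / predecessor /
mirror ball of `q`, and every pooled payer of `b` touches a kept ball within `2` of `z`, hence is kept; degrees of kept
balls within `2` of `z` are unchanged; a twin reading or a blocked target survives deletion trivially; so
`endMultA X b ≤ endMultA X' b` and `pooledDef X b = pooledDef X' b` termwise.
USE (`localSummandA_trans/twin_le_of_deletion_onSite_cx`; the joint row's twin follows the same two lines): if after deleting such
INESSENTIAL balls the window is
ON-SITE for 𝒰_cx, the 𝒰_cx certificates bound the summand of the ORIGINAL window.  So the off-module tails reduce to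
windows whose off-module balls are ESSENTIAL — each touches a kept ball within `2` of the payer — and by the divacancy
laws (`…KissingCageLocal`, `…TwinCageLocal`) and the contact classification (`…ForeignContacts`, `…TwinContacts`) essential
dust sits in the adjacent-divacancy lenses of the hosts near the payer: the universe T3 enumerates.
WHAT THIS IS NOT: not the tails; F-C1 not moved.
-/

noncomputable section

namespace Summit.Ventures.Crystal3D.Theorems

open Summit.Ventures.Crystal3D Finset
open scoped InnerProductSpace

section Deletion

variable {X X' : Finset (EuclideanSpace ℝ (Fin 3))} {z : EuclideanSpace ℝ (Fin 3)}
  (hX : ∀ p ∈ X, ∀ q ∈ X, p ≠ q → 1 ≤ dist p q) (hsub : X' ⊆ X) (hz : z ∈ X')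
  (hD : ∀ x ∈ X, x ∉ X' → ∀ y ∈ X', dist z y ≤ 2 → dist x y ≠ 1)
include hsub hD

omit hsub in
/-- A ball of `X` touching a kept ball within `2` of `z` is kept. -/
theorem mem_of_touch {u y : EuclideanSpace ℝ (Fin 3)} (hu : u ∈ X') (hzu : dist z u ≤ 2) (hy : y ∈ X)
    (hd : dist u y = 1) : y ∈ X' := by
  by_contra hy'
  exact hD y hy hy' u hu hzu (by rw [dist_comm]; exact hd)

/-- The contact set of a kept ball within `2` of `z` is unchanged. -/
theorem contacts_eq_of_deletion {u : EuclideanSpace ℝ (Fin 3)} (hu : u ∈ X') (hzu : dist z u ≤ 2) :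
    (X.filter fun q => dist u q = 1) = X'.filter fun q => dist u q = 1 := by
  ext q
  simp only [mem_filter]
  exact ⟨fun h => ⟨mem_of_touch hD hu hzu h.1 h.2, h.2⟩, fun h => ⟨hsub h.1, h.2⟩⟩

omit hsub in
/-- FULL readings of a kept reader within `2` of `z` survive. -/
theorem isFull_of_deletion {q : EuclideanSpace ℝ (Fin 3)} (hq : q ∈ X') (hzq : dist z q ≤ 2)
    {G : EuclideanSpace ℝ (Fin 3) ≃ₗᵢ[ℝ] EuclideanSpace ℝ (Fin 3)} (h : IsFull X G q) : IsFull X' G q := by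
  intro w hw
  refine mem_of_touch hD hq hzq (h w hw) ?_
  rw [dist_eq_norm, show q - (q + G w) = -(G w) by abel, norm_neg, LinearIsometryEquiv.norm_map,
    norm_eq_one_of_mem_fccSlots hw]

omit hsub in
/-- NARROW readings (unit direction) of a kept reader within `2` of `z` survive. -/
theorem isNarrow_of_deletion {q d : EuclideanSpace ℝ (Fin 3)} (hq : q ∈ X') (hzq : dist z q ≤ 2) (hd : ‖d‖ = 1)
    {G : EuclideanSpace ℝ (Fin 3) ≃ₗᵢ[ℝ] EuclideanSpace ℝ (Fin 3)} (h : IsNarrow X G d q) : IsNarrow X' G d q := by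
  obtain ⟨hqd, m, hmn, hdm, htr⟩ := h
  refine ⟨mem_of_touch hD hq hzq hqd (by rw [dist_eq_norm, show q - (q + d) = -d by abel, norm_neg, hd]),
    m, hmn, hdm, fun w hw hp => mem_of_touch hD hq hzq (htr w hw hp) ?_⟩
  rw [dist_eq_norm, show q - (q + G w) = -(G w) by abel, norm_neg, LinearIsometryEquiv.norm_map,
    norm_eq_one_of_mem_fccSlots hw]

/-- TWIN readings of a kept reader within `2` of `z` survive. -/
theorem isTwinReading_of_deletion {q : EuclideanSpace ℝ (Fin 3)} (hq : q ∈ X') (hzq : dist z q ≤ 2)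
    {G : EuclideanSpace ℝ (Fin 3) ≃ₗᵢ[ℝ] EuclideanSpace ℝ (Fin 3)} {m : EuclideanSpace ℝ (Fin 3)}
    (h : IsTwinReading X G m q) : IsTwinReading X' G m q := by
  obtain ⟨hmn, hlo, hmi, hfa⟩ := h
  have hGw : ∀ w ∈ fccSlots, ‖G w‖ = 1 := fun w hw => by
    rw [LinearIsometryEquiv.norm_map]; exact norm_eq_one_of_mem_fccSlots hw
  refine ⟨hmn, fun w hw hle => mem_of_touch hD hq hzq (hlo w hw hle) ?_,
    fun w hw hlt => mem_of_touch hD hq hzq (hmi w hw hlt) ?_, fun w hw hp hx => hfa w hw hp (hsub hx)⟩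
  · rw [dist_eq_norm, show q - (q + G w) = -(G w) by abel, norm_neg, hGw w hw]
  · rw [dist_eq_norm, show q - (q + (G w - (2 * ⟪G w, m⟫_ℝ) • m)) = -(G w - (2 * ⟪G w, m⟫_ℝ) • m) by abel, norm_neg,
      norm_sub_two_inner_smul_eq_one (hGw w hw) hmn.1]

/-- Conversely a twin reading in `X'` at a kept ball within `2` of `z` is one in `X` (far slots: a ball of `X` there
would touch the kept ball and be kept). -/
theorem isTwinReading_back {b : EuclideanSpace ℝ (Fin 3)} (hb : b ∈ X') (hzb : dist z b ≤ 2)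
    {G : EuclideanSpace ℝ (Fin 3) ≃ₗᵢ[ℝ] EuclideanSpace ℝ (Fin 3)} {m : EuclideanSpace ℝ (Fin 3)}
    (h : IsTwinReading X' G m b) : IsTwinReading X G m b := by
  obtain ⟨hmn, hlo, hmi, hfa⟩ := h
  refine ⟨hmn, fun w hw hle => hsub (hlo w hw hle), fun w hw hlt => hsub (hmi w hw hlt), fun w hw hp hx => ?_⟩
  refine hfa w hw hp (mem_of_touch hD hb hzb hx ?_)
  rw [dist_eq_norm, show b - (b + G w) = -(G w) by abel, norm_neg, LinearIsometryEquiv.norm_map,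
    norm_eq_one_of_mem_fccSlots hw]

/-- The MOVING predicate at a kept ball within `2` of `z` transfers back from `X'` to `X`. -/
theorem isMoving_back {b d : EuclideanSpace ℝ (Fin 3)} (hb : b ∈ X') (hzb : dist z b ≤ 2) (v : WordVersion)
    {G : EuclideanSpace ℝ (Fin 3) ≃ₗᵢ[ℝ] EuclideanSpace ℝ (Fin 3)} (h : IsMoving X' v G d b) : IsMoving X v G d b := by
  rcases h with hf | ⟨m, htw, hdm⟩ | ⟨hv, hn⟩
  · exact Or.inl (isFull_mono hsub hf)
  · exact Or.inr (Or.inl ⟨m, isTwinReading_back hsub hD hb hzb htw, hdm⟩)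
  · exact Or.inr (Or.inr ⟨hv, isNarrow_mono hsub hn⟩)

/-- END MOVES of a kept reader within `2` of `z` onto a kept ball within `2` of `z` survive. -/
theorem isEndMove_of_deletion {q b d : EuclideanSpace ℝ (Fin 3)} (hq : q ∈ X') (hzq : dist z q ≤ 2) (hb : b ∈ X')
    (hzb : dist z b ≤ 2) (hd : ‖d‖ = 1) {v : WordVersion} {G : EuclideanSpace ℝ (Fin 3) ≃ₗᵢ[ℝ] EuclideanSpace ℝ (Fin 3)}
    (h : IsEndMove X v G d q b) : IsEndMove X' v G d q b := by
  unfold IsEndMove at h ⊢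
  rcases h with ⟨hread, hbq, hnm⟩ | ⟨m, htw, hdm, hbq, hnm⟩
  · refine Or.inl ⟨?_, hbq, fun hm => hnm (isMoving_back hsub hD hb hzb v hm)⟩
    rcases hread with hf | ⟨hv, hn⟩ | ⟨m, htw, hdm⟩
    · exact Or.inl (isFull_of_deletion hD hq hzq hf)
    · exact Or.inr (Or.inl ⟨hv, isNarrow_of_deletion hD hq hzq hd hn⟩)
    · exact Or.inr (Or.inr ⟨m, isTwinReading_of_deletion hsub hD hq hzq htw, hdm⟩)
  · exact Or.inr ⟨m, isTwinReading_of_deletion hsub hD hq hzq htw, hdm, hbq,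
      fun hm => hnm (isMoving_back hsub hD hb hzb v hm)⟩

/-- The two-payer clause at a kept ball within `1` of `z` survives (degrees are unchanged). -/
theorem hasTwoPayers_of_deletion {b : EuclideanSpace ℝ (Fin 3)} (hb : b ∈ X') (hzb : dist z b ≤ 1)
    (h : HasTwoPayers X b) : HasTwoPayers X' b := by
  unfold HasTwoPayers at h ⊢
  rcases h with hdeg | ⟨z₁, hz₁, z₂, hz₂, hne, hd₁, hd₂, hc₁, hc₂⟩
  · exact Or.inl (by rwa [← contacts_eq_of_deletion hsub hD hb (by linarith)])
  · have hz₁' : z₁ ∈ X' := mem_of_touch hD hb (by linarith) hz₁ hd₁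
    have hz₂' : z₂ ∈ X' := mem_of_touch hD hb (by linarith) hz₂ hd₂
    have h1 : dist z z₁ ≤ 2 := by linarith [dist_triangle z b z₁]
    have h2 : dist z z₂ ≤ 2 := by linarith [dist_triangle z b z₂]
    refine Or.inr ⟨z₁, hz₁', z₂, hz₂', hne, hd₁, hd₂, ?_, ?_⟩
    · rwa [← contacts_eq_of_deletion hsub hD hz₁' h1]
    · rwa [← contacts_eq_of_deletion hsub hD hz₂' h2]

include hX hz in
/-- A ball of `X` within `1` of `z` is kept. -/
theorem mem_of_dist_le_one {b : EuclideanSpace ℝ (Fin 3)} (hbX : b ∈ X) (hzb : dist z b ≤ 1) : b ∈ X' := by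
  by_cases hbz : b = z
  · rw [hbz]; exact hz
  · have h1 : 1 ≤ dist z b := hX z (hsub hz) b hbX (Ne.symm hbz)
    exact mem_of_touch hD hz (by rw [dist_self]; norm_num) hbX (le_antisymm hzb h1)

variable {v : WordVersion} {S₁ S₂ : PlateSystem}

include hX hz in
/-- **End pairs survive deletion**: an (A)-end pair `(b, q)` of `X` with `b` within `1` of `z` is an (A)-end pair of `X'`. -/
theorem isEndPairA_of_deletion (h₁ : S₁.RT ⊆ fccSlots) (h₂ : S₂.RT ⊆ fccSlots) {b q : EuclideanSpace ℝ (Fin 3)}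
    (hzb : dist z b ≤ 1) (h : IsEndPairA X v S₁ S₂ b q) : IsEndPairA X' v S₁ S₂ b q := by
  have hbq : dist b q = 1 := dist_eq_one_of_isEndPair h₁ h₂ (isEndPair_of_isEndPairA h)
  obtain ⟨hq, hbX, hpay, G, d, hadm, hpred, hmove⟩ := h
  have hd : ‖d‖ = 1 := by
    rcases hadm with ha | ha
    · exact norm_eq_one_of_adm h₁ ha
    · exact norm_eq_one_of_adm h₂ ha
  have hb : b ∈ X' := mem_of_dist_le_one hX hsub hz hD hbX hzb
  have hq' : q ∈ X' := mem_of_touch hD hb (by linarith) hq hbq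
  have hzq : dist z q ≤ 2 := by linarith [dist_triangle z b q]
  have hpred' : q - d ∈ X' :=
    mem_of_touch hD hq' hzq hpred (by rw [dist_eq_norm, show q - (q - d) = d by abel, hd])
  exact ⟨hq', hb, hasTwoPayers_of_deletion hsub hD hb hzb hpay, G, d, hadm, hpred',
    isEndMove_of_deletion hsub hD hq' hzq hb (by linarith) hd hmove⟩

open scoped Classical in
include hX hz in
/-- **Multiplicities**: `endMultA X b ≤ endMultA X' b` for `b` within `1` of `z`. -/
theorem endMultA_le_of_deletion (h₁ : S₁.RT ⊆ fccSlots) (h₂ : S₂.RT ⊆ fccSlots) {b : EuclideanSpace ℝ (Fin 3)}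
    (hzb : dist z b ≤ 1) : endMultA X v S₁ S₂ b ≤ endMultA X' v S₁ S₂ b := by
  unfold endMultA
  refine card_le_card fun q hq => ?_
  rw [mem_filter] at hq ⊢
  have h := isEndPairA_of_deletion hX hsub hz hD h₁ h₂ hzb hq.2
  exact ⟨h.1, h⟩

open scoped Classical in
include hX in
/-- **Pools are unchanged**: `pooledDef X b = pooledDef X' b` for a kept `b` within `1` of `z`. -/
theorem pooledDef_eq_of_deletion {b : EuclideanSpace ℝ (Fin 3)} (hb : b ∈ X') (hzb : dist z b ≤ 1) :
    pooledDef X b = pooledDef X' b := by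
  unfold pooledDef
  have hset : (X.filter fun y => dist b y ≤ 1 ∧ (X.filter fun q => dist y q = 1).card ≤ 11) =
      X'.filter fun y => dist b y ≤ 1 ∧ (X'.filter fun q => dist y q = 1).card ≤ 11 := by
    ext y
    simp only [mem_filter]
    constructor
    · rintro ⟨hy, hby, hdeg⟩
      have hy' : y ∈ X' := by
        by_cases hyb : y = b
        · rw [hyb]; exact hb
        · have h1 : 1 ≤ dist b y := hX b (hsub hb) y hy (Ne.symm hyb)
          exact mem_of_touch hD hb (by linarith) hy (le_antisymm hby h1)
      refine ⟨hy', hby, ?_⟩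
      rwa [← contacts_eq_of_deletion hsub hD hy' (by linarith [dist_triangle z b y])]
    · rintro ⟨hy', hby, hdeg⟩
      refine ⟨hsub hy', hby, ?_⟩
      rwa [contacts_eq_of_deletion hsub hD hy' (by linarith [dist_triangle z b y])]
  rw [hset]
  refine sum_congr rfl fun y hy => ?_
  obtain ⟨hy', hby, -⟩ := mem_filter.1 hy
  rw [contacts_eq_of_deletion hsub hD hy' (by linarith [dist_triangle z b y])]

open scoped Classical in
include hX hz in
/-- **DELETION OF INESSENTIAL BALLS.**  `X' ⊆ X`, `X` `1`-separated, `z ∈ X'`, every deleted ball touches no kept ball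
within `2` of `z`: the (A) summand at `z` does not decrease, for any two plate systems with slot roots. -/
theorem localSummandA_le_of_deletion (h₁ : S₁.RT ⊆ fccSlots) (h₂ : S₂.RT ⊆ fccSlots) :
    localSummandA v S₁ S₂ X z ≤ localSummandA v S₁ S₂ X' z := by
  unfold localSummandA
  have hD' : ∀ b, 0 ≤ (endMultA X' v S₁ S₂ b : ℝ) / pooledDef X' b :=
    fun b => div_nonneg (Nat.cast_nonneg _) (EndRowFloor.pooledDef_nonneg X' b)
  calc ∑ b ∈ X.filter (fun b => dist z b ≤ 1 ∧ 0 < endMultA X v S₁ S₂ b), (endMultA X v S₁ S₂ b : ℝ) / pooledDef X b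
      ≤ ∑ b ∈ X.filter (fun b => dist z b ≤ 1 ∧ 0 < endMultA X v S₁ S₂ b),
          (endMultA X' v S₁ S₂ b : ℝ) / pooledDef X' b := by
        refine sum_le_sum fun b hb => ?_
        obtain ⟨hbX, hzb, -⟩ := mem_filter.1 hb
        rw [pooledDef_eq_of_deletion hX hsub hD (mem_of_dist_le_one hX hsub hz hD hbX hzb) hzb]
        exact div_le_div_of_nonneg_right (by exact_mod_cast endMultA_le_of_deletion hX hsub hz hD h₁ h₂ hzb)
          (EndRowFloor.pooledDef_nonneg X' b)
    _ ≤ ∑ b ∈ X'.filter (fun b => dist z b ≤ 1 ∧ 0 < endMultA X' v S₁ S₂ b),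
          (endMultA X' v S₁ S₂ b : ℝ) / pooledDef X' b := by
        refine sum_le_sum_of_subset_of_nonneg (fun b hb => ?_) fun b _ _ => hD' b
        obtain ⟨hbX, hzb, hpos⟩ := mem_filter.1 hb
        exact mem_filter.2 ⟨mem_of_dist_le_one hX hsub hz hD hbX hzb, hzb,
          lt_of_lt_of_le hpos (endMultA_le_of_deletion hX hsub hz hD h₁ h₂ hzb)⟩

end Deletion

/-! ### Use: deletion onto an on-site window of 𝒰_cx -/

section OnSite

variable {X X' : Finset (EuclideanSpace ℝ (Fin 3))} {z : EuclideanSpace ℝ (Fin 3)} {v : WordVersion} {sF : ℝ}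
  (hX : ∀ p ∈ X, ∀ q ∈ X, p ≠ q → 1 ≤ dist p q) (hsub : X' ⊆ X) (hz : z ∈ X')
  (hD : ∀ x ∈ X, x ∉ X' → ∀ y ∈ X', dist z y ≤ 2 → dist x y ≠ 1) (hsite : OnSiteAt coaxialModuleUniverse X' z)
include hX hsub hz hD hsite

/-- **Translation row**: if deleting inessential balls leaves a window ON-SITE for 𝒰_cx, the 𝒰_cx flat certificate bounds
the ORIGINAL summand. -/
theorem localSummandA_trans_le_of_deletion_onSite_cx (hon : EndRowOnSiteFlatA v sF coaxialModuleUniverse)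
    (L : EuclideanSpace ℝ (Fin 3) ≃ₗᵢ[ℝ] EuclideanSpace ℝ (Fin 3)) :
    localSummandA v ⟨L, inPlaneRoots L 1⟩ ⟨L, inPlaneRoots L (-1)⟩ X z ≤ sF :=
  (localSummandA_le_of_deletion hX hsub hz hD (fun _ h => (mem_filter.1 h).1) (fun _ h => (mem_filter.1 h).1)).trans
    (localSummandA_trans_le_of_onSiteA_menu coaxialModule_menu (fun _ hP => mem_coaxialModule_of_mem_universe hP)
      (endRowOnSiteA_cx_of_flat hon) L hsite)

/-- **Twin row** (half-turn form): the same. -/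
theorem localSummandA_twin_le_of_deletion_onSite_cx (hon : EndRowOnSiteFlatA v sF coaxialModuleUniverse)
    (L : EuclideanSpace ℝ (Fin 3) ≃ₗᵢ[ℝ] EuclideanSpace ℝ (Fin 3)) :
    localSummandA v ⟨L, inPlaneRoots L 1⟩
      ⟨((ℝ ∙ EuclideanSpace.single (2 : Fin 3) (1 : ℝ)).reflection).trans L,
        inPlaneRoots (((ℝ ∙ EuclideanSpace.single (2 : Fin 3) (1 : ℝ)).reflection).trans L) (-1)⟩ X z ≤ sF :=
  (localSummandA_le_of_deletion hX hsub hz hD (fun _ h => (mem_filter.1 h).1) (fun _ h => (mem_filter.1 h).1)).trans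
    (localSummandA_twin_le_of_onSiteA_menu coaxialModule_menu (fun _ hP => mem_coaxialModule_of_mem_universe hP)
      (endRowOnSiteA_cx_of_flat hon) L hsite)

end OnSite

end Summit.Ventures.Crystal3D.Theorems

end
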